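import Summits.QuantumFields.YangMills.Theorems.LuscherReductionDressedRitzPolyakovLiftSymmetricMultiplet
import Summits.QuantumFields.YangMills.Theorems.LuscherReductionDressedRitzPolyakovLiftParitySymmetry
import Summits.QuantumFields.YangMills.Theorems.LuscherReductionDressedRitzPolyakovLiftGramUniversality
import HarnessLib

/-!
# Line «polyakovlift» on crux `DressedRitz` (stmt-QuantumFields-20205), stub S-STAT — CAPSTONE of the symmetry programme:
# `OneSiteSeparatedAt k → Stmt.stub_liftStatics at level k` with `C = 0` (a ONE-type symmetry certificate of the first `k` one-site levels; NO RG input)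

Fleet-service module of seat ym-infvol-p1 g6 (route `LuscherReduction`, femto rung R2b1; holder of S-STAT `stub_liftStatics` on the crux child `DressedRitz` =
stmt-QuantumFields-20205, skeleton r5 `8b6782afbcc2a19a`).  The symmetry zeros of this seat (`…ReflectionSymmetry`, `…ParitySymmetry`,
`…MultipletRecombination`, `…SymmetricMultiplet`; g5's `S₃` zeros) are packaged into ONE sufficient condition for the static clauses that mentions the
fine theory only through a universally valid notion of symmetry:

* `IsLiftSymmetry σ` — a one-site map that preserves physicality and leaves the two-time forms `⟨K_β^a u_F, K_β^b u_H⟩` of flowed-Polyakov insertions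
  invariant for EVERY fine lattice `L`, coupling `β`, raw vacuum and flow time; ★ instances: every axis permutation (`isLiftSymmetry_configPerm`, seat g5),
  the reflection `Θ'₁` (`isLiftSymmetry_negReflect`), compositions (`IsLiftSymmetry.comp`) — hence the whole hyperoctahedral group, in particular the axis
  reflections and the intrinsic parity `P : V ↦ V⁻¹` (`isLiftSymmetry_axisReflect`, `isLiftSymmetry_linkInv`);
* `PairSeparated f h` — a ONE-SITE CERTIFICATE that two channels are exactly uncorrelated: (a) an involutive lift symmetry with `f` even, `h` odd (or vice
  versa), or (b) a symmetric twirl over a finite family of lift symmetries reproducing one and annihilating the other (isotypic separation), or (c) both are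
  orthogonal recombinations of a symmetric multiplet (pairwise involution separation + transitive symmetries);
* ★ `dressed_pair_eq_zero_of_pairSeparated` — `N(g_i,g_l) = 0 = D(g_i,g_l)` for every raw vacuum on every fine lattice;
* ★ `staticClauses_of_pairSeparated` — a lift basis all of whose pairs are separated satisfies `StaticClauses k C β (dressedLiftFamily β φ g)` for EVERY
  `C ≥ 0` ((o0) is the tree's `dressedLiftFamily_o0`);
* `OneSiteSeparatedAt k` — ONE-type statement: for all sufficiently large one-site couplings `B₁ = 2/Λ³` (`Λ ≤ Λ₀`), every lift basis of the first `k`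
  excited levels is pairwise separated;  ★★ `liftStatics_level_of_oneSiteSeparated : OneSiteSeparatedAt k → (level-k text of Stmt.stub_liftStatics, C = 0)`.

WHAT THIS SAYS ABOUT THE CRUX: the static clause (o2) (and, by the same zeros, the coupling clause (o6)) carries NO renormalisation-group content for the
low multiplets — it is symmetry-protected as long as the first `k` excited one-site levels at large `B₁` occupy pairwise distinct `O_h`-isotypes or single
irreducible multiplets (expected for the lowest levels: `E⁺`, `T₂⁺`, `A₁⁺` in the small-volume ordering of [cite: LuscherMunster1984, §4]); the RG core
`GramUniversalityAt` (`CRUX-MAP-r5`) is needed exactly from the first REPEATED isotype on.  HONEST FRAMING: packaging of fixed-lattice symmetry zeros on the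
conditional femto rung R2b1; `OneSiteSeparatedAt k` is an OPEN one-site spectral-classification statement (ONE-type, numerically decidable) and is FALSE for
large `k`; nothing here bears on infinite volume, the continuum limit or the Clay gap.  References: M. Lüscher, NPB 219 (1983) 233, §2–3
[cite: Luscher1983, §2]; M. Lüscher, G. Münster, NPB 232 (1984) 445 [cite: LuscherMunster1984, §4]; M. Lüscher, U. Wolff, NPB 339 (1990) 222 [cite: LuscherWolff1990].
-/

set_option autoImplicit false

noncomputable section

open MeasureTheory Filter Topology
open Literature.MathematicalPhysics.QuantumFieldTheory
open scoped BigOperators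

namespace Summit.QuantumFields.YangMills.Theorems.FemtoTransferGap.PolyakovLift

open Summit.QuantumFields.YangMills.Theorems.FemtoTransferGap

/-! ## §1 Lift symmetries -/

/-- **`IsLiftSymmetry σ`**: the one-site map `σ` preserves physicality and leaves every two-time form of flowed-Polyakov insertions invariant —
`⟨K_β^a u_{F∘σ}, K_β^b u_{H∘σ}⟩ = ⟨K_β^a u_F, K_β^b u_H⟩` for every fine lattice `(ℤ/L)³`, every `β`, every physical exact top eigenfunction `φ`, every flow
time `t` and all `a b`. [cite: Luscher1983, §2] -/
def IsLiftSymmetry (σ : GaugeConfig 3 1 SU2 → GaugeConfig 3 1 SU2) : Prop :=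
  (∀ F : GaugeConfig 3 1 SU2 → ℝ, IsPhys F → IsPhys fun V => F (σ V)) ∧
    ∀ (L : ℕ) [NeZero L] (β : ℝ) (φ : GaugeConfig 3 L SU2 → ℝ), IsPhys φ → transferApply β φ = levelValue su2Rep L β 0 • φ →
      ∀ (t : ℝ) (F H : GaugeConfig 3 1 SU2 → ℝ) (a b : ℕ),
        l2 ((transferApply β)^[a] (OpPlat.ins φ (flowLiftAt (L := L) 0 t fun V => F (σ V))))
            ((transferApply β)^[b] (OpPlat.ins φ (flowLiftAt 0 t fun V => H (σ V)))) =
          l2 ((transferApply β)^[a] (OpPlat.ins φ (flowLiftAt (L := L) 0 t F))) ((transferApply β)^[b] (OpPlat.ins φ (flowLiftAt 0 t H)))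

/-- Every axis permutation is a lift symmetry (seat g5: `IsPhys.comp_configPerm`, `l2_iterIns_comp_configPerm`). [cite: Luscher1983, §2] -/
theorem isLiftSymmetry_configPerm (π : Equiv.Perm (Fin 3)) : IsLiftSymmetry fun V => configPerm π V :=
  ⟨fun _ hF => hF.comp_configPerm π, fun _ _ β _ hφ heig t F H a b => l2_iterIns_comp_configPerm β hφ heig π t F H a b⟩

/-- The reflection `Θ'₁` is a lift symmetry (`IsPhys.comp_negReflect`, `l2_iterIns_comp_negReflect`). [cite: Luscher1983, §2] -/
theorem isLiftSymmetry_negReflect : IsLiftSymmetry fun V : GaugeConfig 3 1 SU2 => V.negReflect :=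
  ⟨fun _ hF => hF.comp_negReflect, fun _ _ β _ hφ heig t F H a b => l2_iterIns_comp_negReflect β hφ heig t F H a b⟩

/-- Lift symmetries compose: `V ↦ σ (σ' V)`. [folklore] -/
theorem IsLiftSymmetry.comp {σ σ' : GaugeConfig 3 1 SU2 → GaugeConfig 3 1 SU2} (hσ : IsLiftSymmetry σ) (hσ' : IsLiftSymmetry σ') :
    IsLiftSymmetry fun V => σ (σ' V) := by
  refine ⟨fun F hF => hσ'.1 _ (hσ.1 F hF), fun L _ β φ hφ heig t F H a b => ?_⟩
  exact (hσ'.2 L β φ hφ heig t (fun W => F (σ W)) (fun W => H (σ W)) a b).trans (hσ.2 L β φ hφ heig t F H a b)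

/-- The axis reflection `R_k = (0 k)·Θ'₁·(0 k)` is a lift symmetry. [cite: Luscher1983, §2] -/
theorem isLiftSymmetry_axisReflect (k : Fin 3) :
    IsLiftSymmetry fun V : GaugeConfig 3 1 SU2 => configPerm (Equiv.swap 0 k) ((configPerm (Equiv.swap 0 k) V).negReflect) :=
  (isLiftSymmetry_configPerm (Equiv.swap 0 k)).comp (isLiftSymmetry_negReflect.comp (isLiftSymmetry_configPerm (Equiv.swap 0 k)))

/-- The intrinsic parity `P : V ↦ V⁻¹` (total link inversion) is a lift symmetry (`P = R₀R₁R₂`). [cite: LuscherMunster1984, §4] -/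
theorem isLiftSymmetry_linkInv : IsLiftSymmetry fun V : GaugeConfig 3 1 SU2 => fun e => (V e)⁻¹ := by
  have h := (isLiftSymmetry_axisReflect 0).comp ((isLiftSymmetry_axisReflect 1).comp (isLiftSymmetry_axisReflect 2))
  refine ⟨fun F hF => ?_, fun L _ β φ hφ heig t F H a b => ?_⟩
  · simpa only [linkInv_eq_axisReflects] using h.1 F hF
  · simpa only [linkInv_eq_axisReflects] using h.2 L β φ hφ heig t F H a b

/-! ## §2 One-site separation certificates -/

/-- **`PairSeparated f h`** — a one-site certificate that the channels `f`, `h` are exactly uncorrelated in every fine theory: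
(a) an involutive lift symmetry with `f` even and `h` odd, or `h` even and `f` odd; or
(b) a finite family of lift symmetries, closed under an involutive inverse pairing, with a symmetric weight whose twirl reproduces one of `f`, `h` and
annihilates the other (isotypic separation); or
(c) `f`, `h` are orthogonal recombinations of a physical family `e` that is pairwise separated by involutive lift symmetries and transitively related by lift
symmetries (a symmetric multiplet). [cite: Luscher1983, §2] -/
def PairSeparated (f h : GaugeConfig 3 1 SU2 → ℝ) : Prop :=
  (∃ σ : GaugeConfig 3 1 SU2 → GaugeConfig 3 1 SU2, IsLiftSymmetry σ ∧ (∀ V, σ (σ V) = V) ∧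
      (((∀ V, f (σ V) = f V) ∧ (∀ V, h (σ V) = -h V)) ∨ ((∀ V, h (σ V) = h V) ∧ (∀ V, f (σ V) = -f V)))) ∨
  (∃ (J : Type) (_ : Fintype J) (γ : J → GaugeConfig 3 1 SU2 → GaugeConfig 3 1 SU2) (ι : J ≃ J) (w : J → ℝ),
      (∀ j, IsLiftSymmetry (γ j)) ∧ (∀ j V, γ j (γ (ι j) V) = V) ∧ (∀ j, w (ι j) = w j) ∧
      (((∀ V, ∑ j, w j * f (γ j V) = f V) ∧ (∀ V, ∑ j, w j * h (γ j V) = 0)) ∨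
        ((∀ V, ∑ j, w j * h (γ j V) = h V) ∧ (∀ V, ∑ j, w j * f (γ j V) = 0)))) ∨
  (∃ (n : ℕ) (e : Fin n → (GaugeConfig 3 1 SU2 → ℝ)) (a₀ : Fin n) (σ : Fin n → Fin n → GaugeConfig 3 1 SU2 → GaugeConfig 3 1 SU2)
      (τ : Fin n → GaugeConfig 3 1 SU2 → GaugeConfig 3 1 SU2) (p q : Fin n → ℝ),
      (∀ a, IsPhys (e a)) ∧
      (∀ a b, a ≠ b → IsLiftSymmetry (σ a b) ∧ (∀ V, σ a b (σ a b V) = V) ∧ (∀ V, e a (σ a b V) = e a V) ∧ (∀ V, e b (σ a b V) = -e b V)) ∧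
      (∀ a, IsLiftSymmetry (τ a) ∧ ∃ ε : ℝ, ε ^ 2 = 1 ∧ ∀ V, e a₀ (τ a V) = ε * e a V) ∧
      (∑ a, p a * q a = 0) ∧ (∀ V, f V = ∑ a, p a * e a V) ∧ (∀ V, h V = ∑ a, q a * e a V))

section Zeros

variable {L : ℕ} [NeZero L]

/-- ★ **Separated channels are exactly uncorrelated and uncoupled** on every fine lattice, for every raw vacuum: `⟨u'_f, u'_h⟩ = 0` and `⟨u'_f, K_β u'_h⟩ = 0`.
[cite: Luscher1983, §2] [cite: LuscherWolff1990] -/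
theorem dressed_pair_eq_zero_of_pairSeparated (β : ℝ) {φ : GaugeConfig 3 L SU2 → ℝ} (hvac : IsRawVacuum β φ)
    {f h : GaugeConfig 3 1 SU2 → ℝ} (hf : IsPhys f) (hh : IsPhys h) (hsep : PairSeparated f h) :
    l2 (dressedLiftVec β φ f) (dressedLiftVec β φ h) = 0 ∧ l2 (dressedLiftVec β φ f) (transferApply β (dressedLiftVec β φ h)) = 0 := by
  have hφ : IsPhys φ := hvac.1
  have heig : transferApply β φ = levelValue su2Rep L β 0 • φ := hvac.2.2
  have hfP : IsPhys (dressedLiftVec β φ f) := isPhys_dressedLiftVec β hφ hf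
  have hhP : IsPhys (dressedLiftVec β φ h) := isPhys_dressedLiftVec β hφ hh
  rcases hsep with ⟨σ, hσ, hinv, hpar⟩ | ⟨J, hJ, γ, ι, w, hγ, hγι, hw, htw⟩ | ⟨n, e, a₀, σ, τ, p, q, he, hσ, hτ, hpq, hfe, hhe⟩
  · -- (a) involution
    have hσinv := fun F H a b => hσ.2 L β φ hφ heig (flowTime β L) F H a b
    rcases hpar with ⟨heven, hodd⟩ | ⟨heven, hodd⟩
    · obtain ⟨h0, h1, -⟩ := l2_dressed_pair_eq_zero_of_involution β hφ σ hinv hσ.1 hσinv hf hh heven hodd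
      exact ⟨h0, h1⟩
    · obtain ⟨h0, -, h2⟩ := l2_dressed_pair_eq_zero_of_involution β hφ σ hinv hσ.1 hσinv hh hf heven hodd
      exact ⟨by rw [l2_comm]; exact h0, h2⟩
  · -- (b) twirl, via the `Fin 2`-family `![f, h]`
    let g : Fin 2 → (GaugeConfig 3 1 SU2 → ℝ) := ![f, h]
    have hg : ∀ j, IsPhys (g j) := fun j => by fin_cases j <;> assumption
    have hphys : ∀ j (F : GaugeConfig 3 1 SU2 → ℝ), IsPhys F → IsPhys fun V => F (γ j V) := fun j F hF => (hγ j).1 F hF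
    have hinvγ : ∀ j (F H : GaugeConfig 3 1 SU2 → ℝ), IsPhys F → IsPhys H → ∀ a b : ℕ,
        l2 ((transferApply β)^[a] (OpPlat.ins φ (flowLiftAt (L := L) 0 (flowTime β L) fun V => F (γ j V))))
            ((transferApply β)^[b] (OpPlat.ins φ (flowLiftAt 0 (flowTime β L) fun V => H (γ j V)))) =
          l2 ((transferApply β)^[a] (OpPlat.ins φ (flowLiftAt (L := L) 0 (flowTime β L) F)))
            ((transferApply β)^[b] (OpPlat.ins φ (flowLiftAt 0 (flowTime β L) H))) :=
      fun j F H _ _ a b => (hγ j).2 L β φ hφ heig (flowTime β L) F H a b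
    rcases htw with ⟨hfix, hann⟩ | ⟨hfix, hann⟩
    · exact
        let r := l2_dressed_pair_eq_zero_of_twirl β hφ γ ι hγι hphys hinvγ w hw hg 0 1 hfix hann
        ⟨r.1, r.2.1⟩
    · have r := l2_dressed_pair_eq_zero_of_twirl β hφ γ ι hγι hphys hinvγ w hw hg 1 0 hfix hann
      exact ⟨by rw [l2_comm]; exact r.1, r.2.2⟩
  · -- (c) symmetric multiplet
    have hσ' : ∀ a b, a ≠ b →
        (∀ V, σ a b (σ a b V) = V) ∧ (∀ F : GaugeConfig 3 1 SU2 → ℝ, IsPhys F → IsPhys fun V => F (σ a b V)) ∧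
        (∀ (F H : GaugeConfig 3 1 SU2 → ℝ) (s t : ℕ),
          l2 ((transferApply β)^[s] (OpPlat.ins φ (flowLiftAt (L := L) 0 (flowTime β L) fun V => F (σ a b V))))
              ((transferApply β)^[t] (OpPlat.ins φ (flowLiftAt 0 (flowTime β L) fun V => H (σ a b V)))) =
            l2 ((transferApply β)^[s] (OpPlat.ins φ (flowLiftAt (L := L) 0 (flowTime β L) F)))
              ((transferApply β)^[t] (OpPlat.ins φ (flowLiftAt 0 (flowTime β L) H)))) ∧
        (∀ V, e a (σ a b V) = e a V) ∧ (∀ V, e b (σ a b V) = -e b V) := fun a b hab => by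
      obtain ⟨hls, hinv, heven, hodd⟩ := hσ a b hab
      exact ⟨hinv, hls.1, fun F H s t => hls.2 L β φ hφ heig (flowTime β L) F H s t, heven, hodd⟩
    have hτ' : ∀ a,
        (∀ (F H : GaugeConfig 3 1 SU2 → ℝ) (s t : ℕ),
          l2 ((transferApply β)^[s] (OpPlat.ins φ (flowLiftAt (L := L) 0 (flowTime β L) fun V => F (τ a V))))
              ((transferApply β)^[t] (OpPlat.ins φ (flowLiftAt 0 (flowTime β L) fun V => H (τ a V)))) =
            l2 ((transferApply β)^[s] (OpPlat.ins φ (flowLiftAt (L := L) 0 (flowTime β L) F)))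
              ((transferApply β)^[t] (OpPlat.ins φ (flowLiftAt 0 (flowTime β L) H)))) ∧
        ∃ ε : ℝ, ε ^ 2 = 1 ∧ ∀ V, e a₀ (τ a V) = ε * e a V := fun a => by
      obtain ⟨hls, hε⟩ := hτ a
      exact ⟨fun F H s t => hls.2 L β φ hφ heig (flowTime β L) F H s t, hε⟩
    obtain ⟨hN, hD⟩ := scalarBlock_of_symmetries β hφ he a₀ σ hσ' τ hτ'
    have hf' : f = fun V => ∑ a, p a * e a V := funext hfe
    have hh' : h = fun V => ∑ a, q a * e a V := funext hhe
    refine ⟨?_, ?_⟩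
    · rw [hf', hh', l2_dressed_recombine_of_scalar β hφ he hN p q, hpq, mul_zero]
    · rw [hf', hh', l2_dressed_transferApply_recombine_of_scalar β hφ he hD p q, hpq, mul_zero]

/-- ★ **The static clauses for a pairwise separated lift basis, with ANY `C ≥ 0`** ((o0) = tree `dressedLiftFamily_o0`; (o2) exact).
[cite: Luscher1983, §2] [cite: LuscherWolff1990] -/
theorem staticClauses_of_pairSeparated {lam β : ℝ} (hlam : 0 < lam) (hW : InFemtoWindow lam β L) {φ : GaugeConfig 3 L SU2 → ℝ}
    (hvac : IsRawVacuum β φ) {k : ℕ} {ω : GaugeConfig 3 1 SU2 → ℝ} {g : Fin k → (GaugeConfig 3 1 SU2 → ℝ)}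
    (hbasis : LiftBasis (liftCoupling β L) k ω g) (hsep : ∀ i l : Fin k, i ≠ l → PairSeparated (g i) (g l)) {C : ℝ} (hC : 0 ≤ C) :
    StaticClauses k C β (dressedLiftFamily β φ g) := by
  have hg : ∀ j, IsPhys (g j) := hbasis.2.2.2.2.1
  refine ⟨dressedLiftFamily_o0 hlam hW hvac hbasis, fun i l hil => ?_⟩
  have h0 : l2 (dressedLiftFamily β φ g i) (dressedLiftFamily β φ g l) = 0 :=
    (dressed_pair_eq_zero_of_pairSeparated β hvac (hg i) (hg l) (hsep i l hil)).1
  rw [h0, abs_zero]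
  exact mul_nonneg (mul_nonneg hC (KTRCalibration.luscherLambda_nonneg β L)) (mul_nonneg (Real.sqrt_nonneg _) (Real.sqrt_nonneg _))

/-- ★ **The coupling clause (o6) of `DynamicCoreClauses` for a separated pair, with ANY `C ≥ 0`** (both `d_il` and `⟨u'_i,u'_l⟩` vanish).
[cite: Luscher1983, §2] [cite: LuscherWolff1990] -/
theorem coreO6_of_pairSeparated (β : ℝ) {φ : GaugeConfig 3 L SU2 → ℝ} (hvac : IsRawVacuum β φ)
    {k : ℕ} {ω : GaugeConfig 3 1 SU2 → ℝ} {B : ℝ} {g : Fin k → (GaugeConfig 3 1 SU2 → ℝ)} (hbasis : LiftBasis B k ω g)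
    {C : ℝ} (hC : 0 ≤ C) (i l : Fin k) (hsep : PairSeparated (g i) (g l)) :
    |l2 (dressedLiftFamily β φ g i) (transferApply β (dressedLiftFamily β φ g l)) -
        (l2 (dressedLiftFamily β φ g i) (transferApply β (dressedLiftFamily β φ g i)) /
              l2 (dressedLiftFamily β φ g i) (dressedLiftFamily β φ g i) +
            l2 (dressedLiftFamily β φ g l) (transferApply β (dressedLiftFamily β φ g l)) /
              l2 (dressedLiftFamily β φ g l) (dressedLiftFamily β φ g l)) / 2 *
          l2 (dressedLiftFamily β φ g i) (dressedLiftFamily β φ g l)|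
      ≤ C * (luscherLambda β L ^ 2 / L) * levelValue su2Rep L β 0 *
          (Real.sqrt (l2 (dressedLiftFamily β φ g i) (dressedLiftFamily β φ g i)) *
            Real.sqrt (l2 (dressedLiftFamily β φ g l) (dressedLiftFamily β φ g l))) := by
  have hg : ∀ j, IsPhys (g j) := hbasis.2.2.2.2.1
  obtain ⟨h0, h1⟩ := dressed_pair_eq_zero_of_pairSeparated β hvac (hg i) (hg l) hsep
  have h0' : l2 (dressedLiftFamily β φ g i) (dressedLiftFamily β φ g l) = 0 := h0
  have h1' : l2 (dressedLiftFamily β φ g i) (transferApply β (dressedLiftFamily β φ g l)) = 0 := h1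
  rw [h1', h0', mul_zero, sub_zero, abs_zero]
  have hl0 : 0 ≤ levelValue su2Rep L β 0 := by rw [levelValue_zero]; exact topValue_nonneg su2Rep L β
  exact mul_nonneg (mul_nonneg (mul_nonneg hC (div_nonneg (sq_nonneg _) (Nat.cast_nonneg _))) hl0)
    (mul_nonneg (Real.sqrt_nonneg _) (Real.sqrt_nonneg _))

end Zeros

/-! ## §3 ★★ S-STAT at a level from a one-site separation statement -/

/-- **`OneSiteSeparatedAt k`** — ONE-type statement about the one-site model alone: for all sufficiently large Polyakov-scale couplings `B₁ = 2/Λ³`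
(`0 < Λ ≤ Λ₀`), EVERY lift basis `(ω, g)` of the first `k` excited levels of `K_{B₁}` is pairwise separated (`PairSeparated (g i) (g l)`, `i ≠ l`) — i.e. the
first `k` excited levels occupy pairwise distinct `O_h`-isotypes or single symmetric multiplets. [cite: Luscher1983, §3] [cite: LuscherMunster1984, §4] -/
def OneSiteSeparatedAt (k : ℕ) : Prop :=
  ∃ lam0 : ℝ, 0 < lam0 ∧ ∀ Λ : ℝ, 0 < Λ → Λ ≤ lam0 →
    ∀ (ω : GaugeConfig 3 1 SU2 → ℝ) (g : Fin k → (GaugeConfig 3 1 SU2 → ℝ)), LiftBasis (2 / Λ ^ 3) k ω g →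
      ∀ i l : Fin k, i ≠ l → PairSeparated (g i) (g l)

/-- ★★ **S-STAT at level `k` from one-site separation, with `C = 0` and NO renormalisation-group input**: `OneSiteSeparatedAt k` implies the level-`k`
text of the registered `Stmt.stub_liftStatics` (every `lam ≤ Λ₀/2`, every `L ≥ 1`, every `β` in the window, every raw vacuum, every lift basis; `B₁ =
liftCoupling β L = 2/λ³` with `λ ≤ 2·lam ≤ Λ₀`). [cite: Luscher1983, §3] [cite: LuscherWolff1990] -/
theorem liftStatics_level_of_oneSiteSeparated {k : ℕ} (h : OneSiteSeparatedAt k) :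
    ∃ C lam0 : ℝ, 0 ≤ C ∧ 0 < lam0 ∧ ∀ lam : ℝ, 0 < lam → lam ≤ lam0 → ∃ L0 : ℕ,
      ∀ (L : ℕ) [NeZero L], L0 ≤ L → ∀ β : ℝ, InFemtoWindow lam β L →
        ∀ φ : GaugeConfig 3 L SU2 → ℝ, IsRawVacuum β φ →
          ∀ (ω : GaugeConfig 3 1 SU2 → ℝ) (g : Fin k → (GaugeConfig 3 1 SU2 → ℝ)), LiftBasis (liftCoupling β L) k ω g →
            StaticClauses k C β (dressedLiftFamily β φ g) := by
  obtain ⟨Λ0, hΛ0, hk⟩ := h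
  refine ⟨0, Λ0 / 2, le_rfl, by positivity, fun lam hlam hle => ⟨0, fun L _ _ β hW φ hvac ω g hbasis => ?_⟩⟩
  have hΛpos : 0 < luscherLambda β L := luscherLambda_pos_of_window hlam hW
  have hΛle : luscherLambda β L ≤ Λ0 := hW.2.2.trans (by linarith)
  have hsep := hk (luscherLambda β L) hΛpos hΛle ω g hbasis
  exact staticClauses_of_pairSeparated hlam hW hvac hbasis hsep le_rfl

/-- The same for ALL levels at once: if every level is one-site separated (a hypothesis that FAILS for large `k` — isotypes repeat), the registered text
`LiftStaticsR3` holds with `C = 0`.  Recorded only to make the logical form explicit; the honest use is level by level. [cite: Luscher1983, §3] -/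
theorem liftStaticsR3_of_oneSiteSeparated (h : ∀ k, OneSiteSeparatedAt k) : LiftStaticsR3 :=
  fun k => liftStatics_level_of_oneSiteSeparated (h k)

end Summit.QuantumFields.YangMills.Theorems.FemtoTransferGap.PolyakovLift

end
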